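import Mathlib
import Summits.NavierStokesRegularity.NavierStokesRegularity.Theorems.FilamentSkeletonRssSkeletonJ1RSwDefectVariation
import Summits.NavierStokesRegularity.NavierStokesRegularity.Theorems.FilamentSkeletonRssMatchedKernelDirectionalDeriv
import Summits.NavierStokesRegularity.NavierStokesRegularity.Theorems.FilamentSkeletonRssSkeletonJ1RLiaSelfSplit
import Summits.NavierStokesRegularity.NavierStokesRegularity.Theorems.FilamentSkeletonRssSkeletonJ1RLiaReference

/-!
# Crux `SkeletonJ1R` (stmt-NavierStokesRegularity-23610) · line `streamline_kantorovich_R` · toward stub F2-d (`LiaDefectDerivBL`, v7):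
# THE SWITCHED NORMAL DEFECT IS DIFFERENTIABLE ALONG THE FILAMENT, WITH AN EXPLICIT DERIVATIVE

Lead `ns-fsr-lead-23610` g2, `--supports stmt-NavierStokesRegularity-23610 --as helper`.  MODEL rung, NEGATIVE side of the ladder: calculus for a
HYPOTHETICAL filament-type blow-up skeleton; nothing here is a claim about Navier–Stokes regularity; the stub and the crux stay OPEN.

WHY.  The registered stub F2-d (`…SkeletonJ1RLineDefs` §5 `LiaDefectDerivBL`, skeleton v7) asks for `HasDerivAt (σ' ↦ swDefect Γ Rb γ α M x j σ') D' τ`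
with a collar bound on `ℓ‖D'‖`.  This file supplies the EXISTENCE half with the EXPLICIT derivative (the companion of `…SwDefectVariation.swDefect_hasDerivAt`,
which varies the filaments; here the filaments are fixed and the parameter moves): for `C²` proper filaments `x k` (`‖x_k′‖ ≤ 1`, `c|σ| − C ≤ ‖x_k σ‖`),
`M` differentiable at `x_j τ`, `x_j′ τ ≠ 0`,
* `hasDerivAt_switchWeight_comp` — the switch weight (smooth: `…LiaReference.contDiff_switchWeight`) along any differentiable point path, explicit scalar derivative
  `(smoothTransition)′(1 − (‖y‖²/ℓ² + 1 − 2s)) · (−2⟪y, y′⟫/ℓ²)`;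
* `trueField_differentiable`, `hasDerivAt_trueField_comp`, `trueField_fderiv_apply` — the TRUE field of fixed filaments is differentiable in the
  evaluation point (tree: `MatchedKernel.matchedBiotSavart_differentiable`), with the explicit directional derivative
  `Σ_k (Γγ_k/4π) ∫ [(−3⟪y − x_k σ, v⟫K₅)•x_k′σ × (y − x_k σ) + K₃•x_k′σ × v] dσ + ½v − α e₃ × v` (tree: `matchedBiotSavart_fderiv_apply_eq`);
* `swDefect_hasDerivAt_param` — `τ' ↦ swDefect Γ Rb γ α M x j τ'` has at `τ` the derivative `S′ − ((⟪S₀,P⟫/‖P‖²)•P′ + (((⟪S₀,P′⟫ + ⟪S′,P⟫)‖P‖² −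
  ⟪S₀,P⟫·2⟪P,P′⟫)/‖P‖⁴)•P)` with `P = x_j′ τ`, `P′ = x_j″ τ`, `σ₀ = switchWeight ℓ 1 (x_j τ)`, `σ′ = D(switchWeight ℓ 1)(x_j τ)·P`, `V₀ = trueField x (x_j τ)`,
  `V′ = D(trueField x)(x_j τ)·P`, `S₀ = σ₀V₀ + (1−σ₀)M(x_j τ)`, `S′ = σ′V₀ + σ₀V′ − σ′M(x_j τ) + (1−σ₀)DM(x_j τ)P`.
The BOUND half of F2-d (zones along the collar, one more power of `1/|s|` in the kernels) is separate work.
-/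

set_option linter.dupNamespace false -- `NavierStokesRegularity.NavierStokesRegularity` path/namespace repetition is the tree convention

noncomputable section

namespace Summit.NavierStokesRegularity.NavierStokesRegularity.Theorems.SkeletonJ1RFrame

open Set Function Filter MeasureTheory Real Topology
open Literature.Analysis.FluidPDE
open Summit.NavierStokesRegularity.NavierStokesRegularity.Theorems.MatchedKernel
open Summit.NavierStokesRegularity.NavierStokesRegularity.Theorems.SkeletonJ1RLiaSelf (contDiff_one_deriv)
open scoped InnerProductSpace BigOperators

/-! ## §1 The switch weight along a point path -/

/-- **The switch weight along a differentiable point path**, explicit derivative: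
`d/dτ switchWeight ℓ s (y τ) = (smoothTransition)′(1 − (‖y τ‖²/ℓ² + 1 − 2s)) · (−(2⟪y τ, y′⟫/ℓ²))`. [folklore] -/
theorem hasDerivAt_switchWeight_comp {ℓ s : ℝ} {y : ℝ → EuclideanSpace ℝ (Fin 3)} {y' : EuclideanSpace ℝ (Fin 3)} {τ : ℝ}
    (hy : HasDerivAt y y' τ) :
    HasDerivAt (fun τ' => switchWeight ℓ s (y τ'))
      (deriv Real.smoothTransition (1 - (‖y τ‖ ^ 2 / ℓ ^ 2 + 1 - 2 * s)) * (-(2 * ⟪y τ, y'⟫_ℝ / ℓ ^ 2))) τ := by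
  have hg : HasDerivAt (fun τ' => 1 - (‖y τ'‖ ^ 2 / ℓ ^ 2 + 1 - 2 * s)) (-(2 * ⟪y τ, y'⟫_ℝ / ℓ ^ 2)) τ := by
    have h1 : HasDerivAt (fun τ' => ‖y τ'‖ ^ 2) (2 * ⟪y τ, y'⟫_ℝ) τ := hy.norm_sq
    have h2 := (((h1.div_const (ℓ ^ 2)).add_const 1).sub_const (2 * s)).const_sub 1
    simpa using h2
  have hd : Differentiable ℝ Real.smoothTransition := Real.smoothTransition.contDiff.differentiable one_ne_zero
  have h := (hd _).hasDerivAt.comp τ hg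
  refine h.congr_of_eventuallyEq (Eventually.of_forall fun τ' => ?_)
  simp only [Function.comp, switchWeight, switchProfile]

/-! ## §2 The true field of FIXED filaments is differentiable in the evaluation point -/

variable {N : ℕ} {Γ α c C : ℝ} {γ : Fin N → ℝ} {x : Fin N → ℝ → EuclideanSpace ℝ (Fin 3)}

/-- The TRUE rotating-frame field of fixed `C¹` proper filaments is differentiable in the evaluation point (regularised kernel: matched-core toolkit at
rigid unit cores). [folklore] -/
theorem trueField_differentiable (hc : 0 < c) (hx : ∀ k, ContDiff ℝ 1 (x k)) (hx1 : ∀ k σ, ‖deriv (x k) σ‖ ≤ 1)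
    (hxg : ∀ k σ, c * |σ| - C ≤ ‖x k σ‖) : Differentiable ℝ (trueField Γ γ α x) := by
  have hκ : 0 < Real.exp (-(1 + Real.eulerMascheroniConstant - Real.log 2)) * (1:ℝ) := by positivity
  have hk : ∀ k, Differentiable ℝ (fun y : EuclideanSpace ℝ (Fin 3) => ∫ σ : ℝ,
      ((‖y - x k σ‖ ^ 2 + Real.exp (-(1 + Real.eulerMascheroniConstant - Real.log 2)) * (1:ℝ)) ^ (3 / 2 : ℝ))⁻¹ •
        cross (deriv (x k) σ) (y - x k σ)) := fun k =>
    matchedBiotSavart_differentiable (m := fun _ => Real.exp (-(1 + Real.eulerMascheroniConstant - Real.log 2)) * (1:ℝ))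
      hκ (fun _ => le_rfl) continuous_const hc (hx k) (hx1 k) (hxg k)
  have hbs : Differentiable ℝ (fun y : EuclideanSpace ℝ (Fin 3) => ∑ k, (Γ * γ k / (4 * Real.pi)) • ∫ σ : ℝ,
      ((‖y - x k σ‖ ^ 2 + Real.exp (-(1 + Real.eulerMascheroniConstant - Real.log 2)) * (1:ℝ)) ^ (3 / 2 : ℝ))⁻¹ •
        cross (deriv (x k) σ) (y - x k σ)) := by
    refine Differentiable.fun_sum fun k _ => ?_
    show Differentiable ℝ ((Γ * γ k / (4 * Real.pi)) • fun y : EuclideanSpace ℝ (Fin 3) => ∫ σ : ℝ,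
      ((‖y - x k σ‖ ^ 2 + Real.exp (-(1 + Real.eulerMascheroniConstant - Real.log 2)) * (1:ℝ)) ^ (3 / 2 : ℝ))⁻¹ •
        cross (deriv (x k) σ) (y - x k σ))
    exact (hk k).const_smul _
  have h2 : Differentiable ℝ (fun y : EuclideanSpace ℝ (Fin 3) => (1 / 2 : ℝ) • y) := by
    show Differentiable ℝ ((1 / 2 : ℝ) • (id : EuclideanSpace ℝ (Fin 3) → EuclideanSpace ℝ (Fin 3)))
    exact differentiable_id.const_smul _
  have h3 : Differentiable ℝ (fun y : EuclideanSpace ℝ (Fin 3) => α • cross (EuclideanSpace.single 2 1) y) := by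
    show Differentiable ℝ (α • fun y : EuclideanSpace ℝ (Fin 3) => cross (EuclideanSpace.single 2 1) y)
    exact (crossCLM (EuclideanSpace.single 2 1)).differentiable.const_smul _
  have htf : trueField Γ γ α x = fun y => (∑ k, (Γ * γ k / (4 * Real.pi)) • ∫ σ : ℝ,
      ((‖y - x k σ‖ ^ 2 + Real.exp (-(1 + Real.eulerMascheroniConstant - Real.log 2)) * (1:ℝ)) ^ (3 / 2 : ℝ))⁻¹ •
        cross (deriv (x k) σ) (y - x k σ)) + (1 / 2 : ℝ) • y - α • cross (EuclideanSpace.single 2 1) y := rfl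
  rw [htf]
  exact (hbs.add h2).sub h3

/-- The true field along a differentiable point path: chain rule. [folklore] -/
theorem hasDerivAt_trueField_comp (hc : 0 < c) (hx : ∀ k, ContDiff ℝ 1 (x k)) (hx1 : ∀ k σ, ‖deriv (x k) σ‖ ≤ 1)
    (hxg : ∀ k σ, c * |σ| - C ≤ ‖x k σ‖) {y : ℝ → EuclideanSpace ℝ (Fin 3)} {y' : EuclideanSpace ℝ (Fin 3)} {τ : ℝ}
    (hy : HasDerivAt y y' τ) :
    HasDerivAt (fun τ' => trueField Γ γ α x (y τ')) (fderiv ℝ (trueField Γ γ α x) (y τ) y') τ :=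
  ((trueField_differentiable (Γ := Γ) (γ := γ) (α := α) hc hx hx1 hxg) (y τ)).hasFDerivAt.comp_hasDerivAt τ hy

/-- **Explicit directional derivative of the true field of fixed filaments**:
`D(trueField x)(y)·v = Σ_k (Γγ_k/4π) ∫ [(−3⟪y − x_k σ, v⟫ K₅)•x_k′σ × (y − x_k σ) + K₃•x_k′σ × v] dσ + ½v − α e₃ × v`
(per filament `MatchedKernel.matchedBiotSavart_directionalDeriv`, then uniqueness of the derivative along `s ↦ y + s•v`). [folklore] -/
theorem trueField_fderiv_apply (hc : 0 < c) (hx : ∀ k, ContDiff ℝ 1 (x k)) (hx1 : ∀ k σ, ‖deriv (x k) σ‖ ≤ 1)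
    (hxg : ∀ k σ, c * |σ| - C ≤ ‖x k σ‖) (y v : EuclideanSpace ℝ (Fin 3)) :
    fderiv ℝ (trueField Γ γ α x) y v =
      (∑ k, (Γ * γ k / (4 * Real.pi)) • ∫ σ : ℝ,
          ((-3 * ⟪y - x k σ, v⟫_ℝ *
              ((‖y - x k σ‖ ^ 2 + Real.exp (-(1 + Real.eulerMascheroniConstant - Real.log 2)) * (1:ℝ)) ^ (5 / 2 : ℝ))⁻¹) •
            cross (deriv (x k) σ) (y - x k σ) +
          ((‖y - x k σ‖ ^ 2 + Real.exp (-(1 + Real.eulerMascheroniConstant - Real.log 2)) * (1:ℝ)) ^ (3 / 2 : ℝ))⁻¹ •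
            cross (deriv (x k) σ) v))
        + (1 / 2 : ℝ) • v - α • cross (EuclideanSpace.single 2 1) v := by
  have hκ : 0 < Real.exp (-(1 + Real.eulerMascheroniConstant - Real.log 2)) * (1:ℝ) := by positivity
  -- the per-filament directional derivatives along `s ↦ y + s•v`
  have hk : ∀ k, HasDerivAt (fun s : ℝ => ∫ σ : ℝ,
      ((‖y + s • v - x k σ‖ ^ 2 + Real.exp (-(1 + Real.eulerMascheroniConstant - Real.log 2)) * (1:ℝ)) ^ (3 / 2 : ℝ))⁻¹ •
        cross (deriv (x k) σ) (y + s • v - x k σ))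
      (∫ σ : ℝ, ((-3 * ⟪y - x k σ, v⟫_ℝ *
          ((‖y - x k σ‖ ^ 2 + Real.exp (-(1 + Real.eulerMascheroniConstant - Real.log 2)) * (1:ℝ)) ^ (5 / 2 : ℝ))⁻¹) •
            cross (deriv (x k) σ) (y - x k σ) +
        ((‖y - x k σ‖ ^ 2 + Real.exp (-(1 + Real.eulerMascheroniConstant - Real.log 2)) * (1:ℝ)) ^ (3 / 2 : ℝ))⁻¹ •
          cross (deriv (x k) σ) v)) 0 := fun k =>
    (matchedBiotSavart_directionalDeriv (m := fun _ => Real.exp (-(1 + Real.eulerMascheroniConstant - Real.log 2)) * (1:ℝ))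
      hκ (fun _ => le_rfl) continuous_const hc (hx k) (hx1 k) (hxg k) y v).2
  have hsum := HasDerivAt.fun_sum (u := Finset.univ) fun k _ => (hk k).const_smul (Γ * γ k / (4 * Real.pi))
  have hp : HasDerivAt (fun s : ℝ => y + s • v) v 0 := by
    simpa using ((hasDerivAt_id' (x := (0:ℝ))).smul_const v).const_add y
  have h2 : HasDerivAt (fun s : ℝ => (1 / 2 : ℝ) • (y + s • v)) ((1 / 2 : ℝ) • v) 0 := hp.const_smul (1 / 2 : ℝ)
  have hcross : HasDerivAt (fun s : ℝ => cross (EuclideanSpace.single 2 1) (y + s • v)) (cross (EuclideanSpace.single 2 1) v) 0 :=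
    (crossCLM (EuclideanSpace.single 2 1)).hasFDerivAt.comp_hasDerivAt (0:ℝ) hp
  have h3 : HasDerivAt (fun s : ℝ => α • cross (EuclideanSpace.single 2 1) (y + s • v)) (α • cross (EuclideanSpace.single 2 1) v) 0 :=
    hcross.const_smul α
  have hdir : HasDerivAt (fun s : ℝ => trueField Γ γ α x (y + s • v))
      ((∑ k, (Γ * γ k / (4 * Real.pi)) • ∫ σ : ℝ,
          ((-3 * ⟪y - x k σ, v⟫_ℝ *
              ((‖y - x k σ‖ ^ 2 + Real.exp (-(1 + Real.eulerMascheroniConstant - Real.log 2)) * (1:ℝ)) ^ (5 / 2 : ℝ))⁻¹) •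
            cross (deriv (x k) σ) (y - x k σ) +
          ((‖y - x k σ‖ ^ 2 + Real.exp (-(1 + Real.eulerMascheroniConstant - Real.log 2)) * (1:ℝ)) ^ (3 / 2 : ℝ))⁻¹ •
            cross (deriv (x k) σ) v))
        + (1 / 2 : ℝ) • v - α • cross (EuclideanSpace.single 2 1) v) 0 := by
    refine ((hsum.add h2).sub h3).congr_of_eventuallyEq (Eventually.of_forall fun s => ?_)
    simp only [trueField, bsField, Pi.add_apply, Pi.sub_apply, Pi.smul_apply]
  -- the chain rule along the same line, and uniqueness
  have hchain : HasDerivAt (fun s : ℝ => trueField Γ γ α x (y + s • v)) (fderiv ℝ (trueField Γ γ α x) y v) 0 :=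
    ((trueField_differentiable (Γ := Γ) (γ := γ) (α := α) hc hx hx1 hxg) y).hasFDerivAt.comp_hasDerivAt_of_eq (0:ℝ) hp (by simp)
  exact hchain.unique hdir

/-! ## §3 The switched normal defect along the filament -/

/-- **THE SWITCHED NORMAL DEFECT IS DIFFERENTIABLE ALONG THE FILAMENT, EXPLICITLY** (existence half of stub F2-d): for `C²` proper filaments, `M`
differentiable at `x_j τ` and `x_j′ τ ≠ 0`, `τ' ↦ swDefect Γ Rb γ α M x j τ'` has at `τ` the derivative of the module docstring (`P = x_j′ τ`, `P′ = x_j″ τ`,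
`σ′ = D(switchWeight ℓ 1)(x_j τ)·P`, `V′ = D(trueField x)(x_j τ)·P`, the latter explicit by `trueField_fderiv_apply`, the former by
`hasDerivAt_switchWeight_comp`). [folklore] -/
theorem swDefect_hasDerivAt_param {Rb : ℝ} {M : EuclideanSpace ℝ (Fin 3) → EuclideanSpace ℝ (Fin 3)} (hc : 0 < c)
    (hx : ∀ k, ContDiff ℝ 2 (x k)) (hx1 : ∀ k σ, ‖deriv (x k) σ‖ ≤ 1) (hxg : ∀ k σ, c * |σ| - C ≤ ‖x k σ‖) (j : Fin N) (τ : ℝ)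
    (hM : DifferentiableAt ℝ M (x j τ)) (hP : deriv (x j) τ ≠ 0) :
    HasDerivAt (fun τ' : ℝ => swDefect Γ Rb γ α M x j τ')
      ((fderiv ℝ (switchWeight (Rb * Real.sqrt (Γ * Real.log Γ)) 1) (x j τ) (deriv (x j) τ) • trueField Γ γ α x (x j τ)
          + switchWeight (Rb * Real.sqrt (Γ * Real.log Γ)) 1 (x j τ) • fderiv ℝ (trueField Γ γ α x) (x j τ) (deriv (x j) τ)
          - fderiv ℝ (switchWeight (Rb * Real.sqrt (Γ * Real.log Γ)) 1) (x j τ) (deriv (x j) τ) • M (x j τ)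
          + (1 - switchWeight (Rb * Real.sqrt (Γ * Real.log Γ)) 1 (x j τ)) • fderiv ℝ M (x j τ) (deriv (x j) τ))
        - ((⟪switchWeight (Rb * Real.sqrt (Γ * Real.log Γ)) 1 (x j τ) • trueField Γ γ α x (x j τ)
                + (1 - switchWeight (Rb * Real.sqrt (Γ * Real.log Γ)) 1 (x j τ)) • M (x j τ), deriv (x j) τ⟫_ℝ / ‖deriv (x j) τ‖ ^ 2) •
              deriv (deriv (x j)) τ
            + (((⟪switchWeight (Rb * Real.sqrt (Γ * Real.log Γ)) 1 (x j τ) • trueField Γ γ α x (x j τ)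
                    + (1 - switchWeight (Rb * Real.sqrt (Γ * Real.log Γ)) 1 (x j τ)) • M (x j τ), deriv (deriv (x j)) τ⟫_ℝ
                  + ⟪(fderiv ℝ (switchWeight (Rb * Real.sqrt (Γ * Real.log Γ)) 1) (x j τ) (deriv (x j) τ) • trueField Γ γ α x (x j τ)
                      + switchWeight (Rb * Real.sqrt (Γ * Real.log Γ)) 1 (x j τ) • fderiv ℝ (trueField Γ γ α x) (x j τ) (deriv (x j) τ)
                      - fderiv ℝ (switchWeight (Rb * Real.sqrt (Γ * Real.log Γ)) 1) (x j τ) (deriv (x j) τ) • M (x j τ)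
                      + (1 - switchWeight (Rb * Real.sqrt (Γ * Real.log Γ)) 1 (x j τ)) • fderiv ℝ M (x j τ) (deriv (x j) τ)),
                    deriv (x j) τ⟫_ℝ) * ‖deriv (x j) τ‖ ^ 2
                - ⟪switchWeight (Rb * Real.sqrt (Γ * Real.log Γ)) 1 (x j τ) • trueField Γ γ α x (x j τ)
                    + (1 - switchWeight (Rb * Real.sqrt (Γ * Real.log Γ)) 1 (x j τ)) • M (x j τ), deriv (x j) τ⟫_ℝ *
                  (2 * ⟪deriv (x j) τ, deriv (deriv (x j)) τ⟫_ℝ)) / (‖deriv (x j) τ‖ ^ 2) ^ 2) • deriv (x j) τ)) τ := by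
  set ℓ := Rb * Real.sqrt (Γ * Real.log Γ) with hℓ
  have hx1' : ∀ k, ContDiff ℝ 1 (x k) := fun k => (hx k).of_le (by norm_num)
  -- the point and the tangent along the filament
  have hp : HasDerivAt (x j) (deriv (x j) τ) τ :=
    (((hx j).differentiable (by norm_num)) τ).hasDerivAt
  have hPt : HasDerivAt (fun τ' => deriv (x j) τ') (deriv (deriv (x j)) τ) τ :=
    (((contDiff_one_deriv (hx j)).differentiable one_ne_zero) τ).hasDerivAt
  -- the switch weight along the filament
  have hσd : DifferentiableAt ℝ (switchWeight ℓ 1) (x j τ) :=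
    ((contDiff_switchWeight ℓ 1 (n := 1)).differentiable one_ne_zero).differentiableAt
  have hσ : HasDerivAt (fun τ' => switchWeight ℓ 1 (x j τ')) (fderiv ℝ (switchWeight ℓ 1) (x j τ) (deriv (x j) τ)) τ :=
    hσd.hasFDerivAt.comp_hasDerivAt τ hp
  -- the true field and the model along the filament
  have hV : HasDerivAt (fun τ' => trueField Γ γ α x (x j τ')) (fderiv ℝ (trueField Γ γ α x) (x j τ) (deriv (x j) τ)) τ :=
    hasDerivAt_trueField_comp hc hx1' hx1 hxg hp
  have hMs : HasDerivAt (fun τ' => M (x j τ')) (fderiv ℝ M (x j τ) (deriv (x j) τ)) τ :=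
    hM.hasFDerivAt.comp_hasDerivAt τ hp
  -- the switched field S(τ') and its derivative
  have hS0 := (hσ.smul hV).add (((hasDerivAt_const τ (1:ℝ)).sub hσ).smul hMs)
  have hS : HasDerivAt (fun τ' => switchWeight ℓ 1 (x j τ') • trueField Γ γ α x (x j τ')
      + (1 - switchWeight ℓ 1 (x j τ')) • M (x j τ'))
      (fderiv ℝ (switchWeight ℓ 1) (x j τ) (deriv (x j) τ) • trueField Γ γ α x (x j τ)
        + switchWeight ℓ 1 (x j τ) • fderiv ℝ (trueField Γ γ α x) (x j τ) (deriv (x j) τ)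
        - fderiv ℝ (switchWeight ℓ 1) (x j τ) (deriv (x j) τ) • M (x j τ)
        + (1 - switchWeight ℓ 1 (x j τ)) • fderiv ℝ M (x j τ) (deriv (x j) τ)) τ := by
    refine HasDerivAt.congr_deriv (hS0.congr_of_eventuallyEq (Eventually.of_forall fun s => ?_)) ?_
    · simp only [Pi.add_apply, Pi.smul_apply', Pi.sub_apply]
    · simp only [Pi.sub_apply, zero_sub, neg_smul, sub_smul, one_smul]
      abel
  -- assemble with the tangential projection
  have hproj := hasDerivAt_tangencyDefect (W := fun τ' => switchWeight ℓ 1 (x j τ') • trueField Γ γ α x (x j τ')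
      + (1 - switchWeight ℓ 1 (x j τ')) • M (x j τ')) (P := fun τ' => deriv (x j) τ') hS hPt hP
  refine hproj.congr_of_eventuallyEq (Eventually.of_forall fun s => ?_)
  simp only [swDefect, switchedField, hℓ]

end Summit.NavierStokesRegularity.NavierStokesRegularity.Theorems.SkeletonJ1RFrame

end
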